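import Literature.MathematicalPhysics.QuantumLattice.TwistedMassWilson
import Literature.MathematicalPhysics.QuantumFieldTheory.GammaHermiticity
import HarnessLib

/-!
# Shamir's domain-wall (boundary) fermion operator: the five-dimensional Dirac matrix, its
# `γ₅𝓡`-hermiticity (Furman–Shamir), the real one-flavour determinant and the non-negative
# two-flavour / Pauli–Villars weights — on every lattice gauge field

Topic `MathematicalPhysics/QuantumLattice`, next to `TwistedMassWilson.lean` (whose abstract
`γ₅`-Hermitian API — `TwistedMass.isHermitian_hermQ`, `TwistedMass.tmKernel`, … — and whose Wilson
instance `TwistedMass.conjTranspose_wilsonDirac` are REUSED) and to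
`QuantumFieldTheory/GammaHermiticity.lean` (real determinant of a `Γ`-Hermitian matrix, REUSED).
PUBLISHED RESULTS with our proofs; no named fact (`def … : Prop`) is introduced (D-0026).  The tree
had no domain-wall fermion before this file (`lean search domainWall|Shamir1993` at 2026-08-23: docstring
mentions only, in `Barriers/QuantumFields/NielsenNinomiya.lean`).

## Sources, verbatim

* Y. Shamir, Nucl. Phys. B 406 (1993) 90 = hep-lat/9303005 [Shamir1993], §2 eq. (9): the free
  five-dimensional operator "`D₀(s,s';p) = ½(1+γ₅)δ_{s+1,s'} + ½(1−γ₅)δ_{s−1,s'} − (b(p) + i p̸̄)δ_{s,s'}`",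
  §3 eq. (28) (cut the fifth direction to `0 ≤ s ≤ N`: "`D̂` can be obtained by cutting the link
  connecting the sites `s = 0` and `s = N`") and eq. (29): "`D̂(s,s';m) = D̂(s,s') + (m/2)(1−γ₅)δ_{s,1}δ_{s',N}
  + (m/2)(1+γ₅)δ_{s,N}δ_{s',1}` … `m` indeed plays the role of a Dirac mass for the light fermions".
* V. Furman, Y. Shamir, Nucl. Phys. B 439 (1995) 54 = hep-lat/9405004 [FurmanShamir1995], §2 (the
  interacting model; our TeX copy carries no printed equation numbers, so the displays of §2 are cited
  by their ORDINAL in §2 — "§2 (5th display)" — together with their content):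
  - 5th–8th displays: "`(D_F)_{x,s;y,s'} = δ_{s,s'} D^∥_{x,y} + δ_{x,y} D^⊥_{s,s'}`,
    `D^∥_{x,y} = ½Σ_μ[(1+γ_μ)U_{x,μ}δ_{x+μ̂,y} + (1−γ_μ)U†_{y,μ}δ_{x−μ̂,y}] + (M−4)δ_{x,y}`,
    `D^⊥_{s,s'} = P_R δ_{2,s'} − m P_L δ_{2N,s'} − δ_{1,s'}` (`s = 1`), `P_R δ_{s+1,s'} + P_L δ_{s−1,s'} − δ_{s,s'}`
    (`1 < s < 2N`), `−m P_R δ_{1,s'} + P_L δ_{2N−1,s'} − δ_{2N,s'}` (`s = 2N`), `P_{R,L} = ½(1 ± γ₅)`.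
    Notice that `D^⊥_{s,s'}` is independent of the gauge field. Also, apart from the unconventional
    sign of the mass term, `D^∥_{x,y}` is the usual four dimensional gauge covariant Dirac operator for
    massive Wilson fermions";  "The topology of the fifth dimension is taken to be a circle, but the
    couplings which reside on the links connecting the layers `s = 2N` and `s = 1` are proportional to
    a parameter `−m` … The case `m = 1` corresponds to antiperiodic boundary conditions … The case
    `m = 0` corresponds to open boundaries";
  - 10th display (Pauli–Villars action): "`S_PV = Σ φ† D_F†(N,1) D_F(N,1) φ` … The second order
    operator … is the square of the Dirac operator on a smaller lattice";
  - 11th–14th displays: "Let us denote by `𝓡` the reflection relative to the hyper-plane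
    `s = N + ½`, `(𝓡ψ)_{x,s} = ψ_{x,2N+1−s}`. The Dirac operator `D_F` … satisfies the following identity
    `𝓡γ₅ D_F 𝓡γ₅ = D_F†`. This identity is a generalization of a similar relation obeyed by the four
    dimensional Dirac operator for Wilson fermions, which reads `γ₅ D^∥ γ₅ = (D^∥)†` … reflection implies
    that the operator `γ₅𝓡 D_F` is hermitian. One has `det(γ₅𝓡) = 1` trivially, and so
    `det(D_F) = det(γ₅𝓡 D_F)`. As a result, the fermionic determinant is real. However, one cannot
    conclude that the fermionic determinant is necessarily positive";
  - App. B: "For even `N_f` or for `m > 0`, the factor `(det D_F(U))^{N_f}` is positive."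

## What is formalised (finite matrices over `ℂ`; `n` = number of layers, FS's `2N`; layers are
## `Fin n`, FS's `s = 1, …, 2N` shifted to `0, …, n − 1`)

§1 the fifth direction: the forward hop `sHop n` (`δ_{s+1,s'}`), the wall-to-wall link `sWrap n`
(`δ_{s,2N}δ_{1,s'}`, last layer to first) and the reflection `sReflect n` (`s' = 2N+1−s`, i.e.
`Fin.rev`), with `𝓡² = 1`, `𝓡 A 𝓡 = Aᵀ`, `𝓡 B 𝓡 = Bᵀ`.  §2 the chiral projectors `P_{R,L} = ½(1 ± γ)`
for any `γ` with `γ² = 1`.  §3 for ANY square `D : Matrix ι ι ℂ` and `γ` (the index `ι` bundles site,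
colour and spin; "`δ_{x,y}D^⊥`" is the Kronecker product of the spin matrices `P_{R,L}` with the layer
matrices): `dwPerp γ m n = P_R ⊗ (A − m·B) + P_L ⊗ (Aᵀ − m·Bᵀ) − 1`,
`domainWall γ D m n = D ⊗ 1 + dwPerp γ m n` (FS 5th/7th displays, entrywise: `domainWall_apply`),
the mass enters only through the wall-to-wall links (`domainWall_sub_domainWall`), `m = 0` open /
`m = 1` antiperiodic (`domainWall_zero`, `domainWall_one`), and `dwGamma γ n = γ ⊗ 𝓡` with
`(γ ⊗ 𝓡)² = 1`, `(γ ⊗ 𝓡)† = γ ⊗ 𝓡`.  §4 THE THEOREM `conjTranspose_domainWall`: if `γ† = γ`, `γ² = 1`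
and `D† = γDγ` then `D_F† = (γ ⊗ 𝓡) D_F (γ ⊗ 𝓡)` (FS 12th display from the 13th), hence
`(γ ⊗ 𝓡)D_F` is Hermitian (`isHermitian_dwGamma_mul_domainWall`), `det D_F` is real
(`det_domainWall_im`, `star_det_domainWall`), `det(γ ⊗ 𝓡)² = 1`, the second-order (Pauli–Villars /
two-flavour) operator `D_F†D_F` has determinant `|det D_F|² ≥ 0` (`det_conjTranspose_mul_domainWall`)
and `(det D_F)^{N_f} ≥ 0` for even `N_f` (`det_domainWall_pow_re_nonneg`).  §5 THE INSTANCE for the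
tree's gauge-covariant Wilson–Dirac operator on the four-torus, `wilsonDomainWall ρ U M r m n :=
domainWall Γ₅ (wilsonDirac ρ U M r) m n` — FS's `D_F(2N, m)` at domain-wall height `M` is EXACTLY the
case `(M, r, n) = (M, −1, 2N)`: the tree's `wilsonDirac ρ U M (−1) = (M − 4)δ + ½Σ_μ[(1+γ_μ)ρ(U_{x,μ})δ_{y,x+μ̂}
+ (1−γ_μ)ρ(U_{y,μ})⁻¹δ_{x,y+μ̂}]` is FS's `D^∥` letter for letter (`U† = U⁻¹` for unitary `ρ`), their
"unconventional sign of the mass term" being the tree's `r = −1`; every statement below holds for all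
`(M, r)`: for EVERY gauge field `U`, any gauge group, any unitary colour representation `ρ`, `L ≥ 1`:
`conjTranspose_wilsonDomainWall` (FS 12th display, from the tree's `γ₅ D_W γ₅ = D_W†` = FS 13th display),
`isHermitian_gammaR_mul_wilsonDomainWall`, `det_wilsonDwGamma` (= 1: "det(γ₅𝓡) = 1 trivially"),
`det_wilsonDomainWall_eq_det_gammaR_mul` (14th display verbatim), `det_wilsonDomainWall_im` ("the
fermionic determinant is real"), `det_conjTranspose_mul_wilsonDomainWall` /
`det_wilsonDomainWall_pow_re_nonneg` (App. B, even `N_f`; the PV second-order operator).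

HONEST SCOPE.  NOT here: the positivity of `det D_F` for `m > 0` (FS App. B's other clause, proved in
their §5 through the transfer-matrix representation), the `N → ∞` chiral limit and the effective
four-dimensional (overlap-type) operator, the Möbius / Boriçi generalisations
(`-- TODO(general form): Brower–Neff–Orginos kernels`), even–odd preconditioning of `D_F`, and anything
about forces, solvers or costs.  One operator at a time; nothing about ensembles.  Cell pub-lqcd
(venture `LatticeQCDFlow`): HOME/R2-SCOPE.md §2 row P9 (field-transformation HMC with `N_f = 2+1`
domain-wall quarks — the one printed fermionic FT-HMC gain) and §3 E3 (positivity by construction: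
degenerate pair + Pauli–Villars ratio; the one-flavour determinant is only REAL), FANOUT row 38.

## References
* [Shamir1993] Y. Shamir, Chiral fermions from lattice boundaries, Nucl. Phys. B 406 (1993) 90,
  §2 eq. (9), §3 eqs. (28)–(30).
* [FurmanShamir1995] V. Furman, Y. Shamir, Axial symmetries in lattice QCD with Kaplan fermions,
  Nucl. Phys. B 439 (1995) 54, §2 (5th–8th, 10th–14th displays), App. B.
* [MontvayMunster1994] I. Montvay, G. Münster, Quantum Fields on a Lattice, CUP 1994, §4.2 (4.35)
  (γ₅-hermiticity of the Wilson operator, through the tree's `wilsonDirac_gammaFive_hermitian_holds`).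
-/

namespace Literature.MathematicalPhysics.QuantumLattice.DomainWall

open Matrix
open scoped Kronecker ComplexOrder

/-! ## §1 The fifth direction: forward hop, wall-to-wall link, reflection -/

section Fifth

variable (n : ℕ)

/-- The forward hop along the fifth direction, `A_{s,s'} = δ_{s+1,s'}` (FS: the `P_R δ_{s+1,s'}` term
of `D^⊥`; Shamir (9): `½(1+γ₅)δ_{s+1,s'}`), on `n` layers `s = 0,…,n−1` with NO wrap-around (the link
from the last layer to the first is `sWrap`). [cite: FurmanShamir1995, §2 (7th display, D^⊥)]
[cite: Shamir1993, §2 eq. (9)] -/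
def sHop : Matrix (Fin n) (Fin n) ℂ :=
  Matrix.of fun s t => if t.val = s.val + 1 then 1 else 0

/-- The wall-to-wall link from the LAST layer (`s = 2N` in FS, `s = n − 1` here) to the FIRST
(`s' = 1` in FS, `0` here): `B_{s,s'} = δ_{s,2N}δ_{1,s'}` — the link "connecting the layers `s = 2N` and
`s = 1`" whose coupling is `−m` (Shamir (29): the link "connecting the sites `s = 0` and `s = N`").
[cite: FurmanShamir1995, §2 (7th display, rows s = 1 and s = 2N)] [cite: Shamir1993, §3 eq. (29)] -/
def sWrap : Matrix (Fin n) (Fin n) ℂ :=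
  Matrix.of fun s t => if s.val + 1 = n ∧ t.val = 0 then 1 else 0

/-- The reflection `𝓡` of the fifth direction "relative to the hyper-plane `s = N + ½`",
`(𝓡ψ)_{x,s} = ψ_{x,2N+1−s}`, as the permutation matrix of `Fin.rev` (`s ↦ n − 1 − s`):
`𝓡_{s,s'} = δ_{s', n−1−s}`. [cite: FurmanShamir1995, §2 (11th display, definition of 𝓡)] -/
def sReflect : Matrix (Fin n) (Fin n) ℂ :=
  Matrix.of fun s t => if t = s.rev then 1 else 0

/-- Entries of the forward hop `δ_{s+1,s'}`. [cite: FurmanShamir1995, §2 (7th display, D^⊥)] -/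
theorem sHop_apply (s t : Fin n) : sHop n s t = if t.val = s.val + 1 then 1 else 0 := rfl

/-- Entries of the wall-to-wall link `δ_{s,2N}δ_{1,s'}`. [cite: FurmanShamir1995, §2 (7th display, D^⊥)] -/
theorem sWrap_apply (s t : Fin n) : sWrap n s t = if s.val + 1 = n ∧ t.val = 0 then 1 else 0 := rfl

/-- Entries of the reflection `𝓡_{s,s'} = δ_{s',2N+1−s}`. [cite: FurmanShamir1995, §2 (11th display)] -/
theorem sReflect_apply (s t : Fin n) : sReflect n s t = if t = s.rev then 1 else 0 := rfl

variable {n}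

/-- Left multiplication by `𝓡` reflects the row index. [folklore] -/
private theorem sReflect_mul_apply {κ : Type*} (X : Matrix (Fin n) κ ℂ) (s : Fin n) (u : κ) :
    (sReflect n * X) s u = X s.rev u := by
  simp [Matrix.mul_apply, sReflect_apply]

/-- Right multiplication by `𝓡` reflects the column index. [folklore] -/
private theorem mul_sReflect_apply {κ : Type*} [Fintype κ] (X : Matrix κ (Fin n) ℂ) (u : κ)
    (s : Fin n) : (X * sReflect n) u s = X u s.rev := by
  have h : ∀ t : Fin n, (s = t.rev) ↔ (t = s.rev) := fun t => by
    rw [eq_comm, Fin.rev_eq_iff]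
  simp [Matrix.mul_apply, sReflect_apply, h]

/-- Conjugation by `𝓡` reflects both indices: `(𝓡 Y 𝓡)_{s,s'} = Y_{2N+1−s, 2N+1−s'}`. [folklore] -/
private theorem sReflect_mul_mul_sReflect_apply (Y : Matrix (Fin n) (Fin n) ℂ) (s u : Fin n) :
    (sReflect n * Y * sReflect n) s u = Y s.rev u.rev := by
  rw [mul_sReflect_apply, sReflect_mul_apply]

variable (n)

/-- `𝓡² = 1` (a reflection). [cite: FurmanShamir1995, §2 (11th display: 𝓡 is the reflection s ↦ 2N+1−s)] -/
theorem sReflect_mul_sReflect : sReflect n * sReflect n = 1 := by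
  ext s u
  rw [sReflect_mul_apply, sReflect_apply, Matrix.one_apply, Fin.rev_rev]
  exact if_congr eq_comm rfl rfl

/-- `𝓡ᵀ = 𝓡`. [cite: FurmanShamir1995, §2 (11th display)] -/
theorem transpose_sReflect : (sReflect n)ᵀ = sReflect n := by
  ext s t
  simp only [transpose_apply, sReflect_apply]
  exact if_congr (by rw [eq_comm, Fin.rev_eq_iff]) rfl rfl

/-- `𝓡† = 𝓡` (a real symmetric permutation matrix). [cite: FurmanShamir1995, §2 (11th display)] -/
theorem conjTranspose_sReflect : (sReflect n)ᴴ = sReflect n := by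
  rw [conjTranspose, transpose_sReflect]
  ext s t
  simp [sReflect_apply]

/-- `(det 𝓡)² = 1`. [cite: FurmanShamir1995, §2 (14th display: 'det(γ₅𝓡) = 1 trivially')] -/
theorem det_sReflect_sq : (sReflect n).det ^ 2 = 1 := by
  rw [sq, ← det_mul, sReflect_mul_sReflect, det_one]

/-- **Reflection conjugates the forward hop into the backward hop**: `𝓡 A 𝓡 = Aᵀ`
(`δ_{s+1,s'} ↦ δ_{s−1,s'}` under `s, s' ↦ 2N+1−s, 2N+1−s'`; Shamir (30):
"`D̂₊(s,s') = D̂₋(N−s, N−s')`"). [cite: FurmanShamir1995, §2 (12th display, mechanism)]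
[cite: Shamir1993, §3 eq. (30)] -/
theorem sReflect_mul_sHop_mul_sReflect : sReflect n * sHop n * sReflect n = (sHop n)ᵀ := by
  ext s u
  have hs := s.isLt
  have hu := u.isLt
  rw [sReflect_mul_mul_sReflect_apply, transpose_apply, sHop_apply, sHop_apply, Fin.val_rev,
    Fin.val_rev]
  exact if_congr (by omega) rfl rfl

/-- `𝓡 Aᵀ 𝓡 = A`. [cite: FurmanShamir1995, §2 (12th display, mechanism)] -/
theorem sReflect_mul_sHop_transpose_mul_sReflect :
    sReflect n * (sHop n)ᵀ * sReflect n = sHop n := by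
  ext s u
  have hs := s.isLt
  have hu := u.isLt
  rw [sReflect_mul_mul_sReflect_apply, transpose_apply, sHop_apply, sHop_apply, Fin.val_rev,
    Fin.val_rev]
  exact if_congr (by omega) rfl rfl

/-- **Reflection reverses the wall-to-wall link**: `𝓡 B 𝓡 = Bᵀ` (the link `2N → 1` becomes `1 → 2N`).
[cite: FurmanShamir1995, §2 (12th display, mechanism)] -/
theorem sReflect_mul_sWrap_mul_sReflect : sReflect n * sWrap n * sReflect n = (sWrap n)ᵀ := by
  ext s u
  have hs := s.isLt
  have hu := u.isLt
  rw [sReflect_mul_mul_sReflect_apply, transpose_apply, sWrap_apply, sWrap_apply, Fin.val_rev,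
    Fin.val_rev]
  exact if_congr (by omega) rfl rfl

/-- `𝓡 Bᵀ 𝓡 = B`. [cite: FurmanShamir1995, §2 (12th display, mechanism)] -/
theorem sReflect_mul_sWrap_transpose_mul_sReflect :
    sReflect n * (sWrap n)ᵀ * sReflect n = sWrap n := by
  ext s u
  have hs := s.isLt
  have hu := u.isLt
  rw [sReflect_mul_mul_sReflect_apply, transpose_apply, sWrap_apply, sWrap_apply, Fin.val_rev,
    Fin.val_rev]
  exact if_congr (by omega) rfl rfl

/-- The hop matrix is real: `A† = Aᵀ`. [folklore] -/
private theorem conjTranspose_sHop : (sHop n)ᴴ = (sHop n)ᵀ := by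
  ext s t
  simp [conjTranspose_apply, transpose_apply, sHop_apply, apply_ite (star : ℂ → ℂ)]

/-- `(Aᵀ)† = A`. [folklore] -/
private theorem conjTranspose_sHop_transpose : ((sHop n)ᵀ)ᴴ = sHop n := by
  ext s t
  simp [conjTranspose_apply, transpose_apply, sHop_apply, apply_ite (star : ℂ → ℂ)]

/-- The link matrix is real: `B† = Bᵀ`. [folklore] -/
private theorem conjTranspose_sWrap : (sWrap n)ᴴ = (sWrap n)ᵀ := by
  ext s t
  simp [conjTranspose_apply, transpose_apply, sWrap_apply, apply_ite (star : ℂ → ℂ)]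

/-- `(Bᵀ)† = B`. [folklore] -/
private theorem conjTranspose_sWrap_transpose : ((sWrap n)ᵀ)ᴴ = sWrap n := by
  ext s t
  simp [conjTranspose_apply, transpose_apply, sWrap_apply, apply_ite (star : ℂ → ℂ)]

end Fifth

/-! ## §2 The chiral projectors `P_{R,L} = ½(1 ± γ₅)` -/

section Projectors

variable {ι : Type} [DecidableEq ι] (γ : Matrix ι ι ℂ)

/-- `P_R = ½(1 + γ₅)`. [cite: FurmanShamir1995, §2 (8th display, P_{R,L} = ½(1 ± γ₅))] -/
noncomputable def projR : Matrix ι ι ℂ := (2 : ℂ)⁻¹ • (1 + γ)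

/-- `P_L = ½(1 − γ₅)`. [cite: FurmanShamir1995, §2 (8th display, P_{R,L} = ½(1 ± γ₅))] -/
noncomputable def projL : Matrix ι ι ℂ := (2 : ℂ)⁻¹ • (1 - γ)

/-- Unfolding lemma for `P_R`. [cite: FurmanShamir1995, §2 (8th display)] -/
theorem projR_def : projR γ = (2 : ℂ)⁻¹ • (1 + γ) := rfl

/-- Unfolding lemma for `P_L`. [cite: FurmanShamir1995, §2 (8th display)] -/
theorem projL_def : projL γ = (2 : ℂ)⁻¹ • (1 - γ) := rfl

/-- `P_R + P_L = 1`. [cite: FurmanShamir1995, §2 (8th display)] -/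
theorem projR_add_projL : projR γ + projL γ = 1 := by
  rw [projR, projL, ← smul_add, add_add_sub_cancel, ← two_smul ℂ, smul_smul,
    inv_mul_cancel₀ two_ne_zero, one_smul]

variable {γ}

/-- `P_R† = P_R` for Hermitian `γ₅`. [cite: FurmanShamir1995, §2 (8th display)] -/
theorem conjTranspose_projR (hγ : γᴴ = γ) : (projR γ)ᴴ = projR γ := by
  simp [projR, conjTranspose_smul, conjTranspose_add, hγ]

/-- `P_L† = P_L` for Hermitian `γ₅`. [cite: FurmanShamir1995, §2 (8th display)] -/
theorem conjTranspose_projL (hγ : γᴴ = γ) : (projL γ)ᴴ = projL γ := by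
  simp [projL, conjTranspose_smul, conjTranspose_sub, hγ]

variable [Fintype ι]

/-- `γ₅ P_R γ₅ = P_R` (from `γ₅² = 1`). [cite: FurmanShamir1995, §2 (8th display)] -/
theorem gamma_mul_projR_mul_gamma (hγγ : γ * γ = 1) : γ * projR γ * γ = projR γ := by
  simp only [projR, Matrix.mul_smul, Matrix.smul_mul, Matrix.mul_add, Matrix.mul_one, hγγ,
    Matrix.add_mul, Matrix.one_mul]

/-- `γ₅ P_L γ₅ = P_L` (from `γ₅² = 1`). [cite: FurmanShamir1995, §2 (8th display)] -/
theorem gamma_mul_projL_mul_gamma (hγγ : γ * γ = 1) : γ * projL γ * γ = projL γ := by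
  simp only [projL, Matrix.mul_smul, Matrix.smul_mul, Matrix.mul_sub, Matrix.mul_one, hγγ,
    Matrix.sub_mul, Matrix.one_mul]

end Projectors

/-! ## §3 The domain-wall operator `D_F = δ_{ss'}D^∥ + δ_{xy}D^⊥` over any kernel `D` -/

section Operator

variable {ι : Type}

section Defs

variable [DecidableEq ι] (γ D : Matrix ι ι ℂ) (m : ℝ) (n : ℕ)

/-- **"`δ_{x,y} D^⊥_{s,s'}`"**, the gauge-field-independent fifth-direction part of the domain-wall
operator, as a matrix on `ι × Fin n` (`ι` = site × colour × spin carries the projectors, `Fin n` the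
layers): `P_R ⊗ (A − m·B) + P_L ⊗ (Aᵀ − m·Bᵀ) − 1`, i.e. row by row FS's
`P_R δ_{s+1,s'} + P_L δ_{s−1,s'} − δ_{s,s'}` in the interior, with the extra wall-to-wall couplings
`−m P_L δ_{2N,s'}` on the first layer and `−m P_R δ_{1,s'}` on the last.
[cite: FurmanShamir1995, §2 (7th display, D^⊥)] [cite: Shamir1993, §3 eq. (29)] -/
noncomputable def dwPerp : Matrix (ι × Fin n) (ι × Fin n) ℂ :=
  projR γ ⊗ₖ (sHop n - (m : ℂ) • sWrap n) + projL γ ⊗ₖ ((sHop n)ᵀ - (m : ℂ) • (sWrap n)ᵀ) - 1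

/-- **The domain-wall fermion matrix** `(D_F)_{x,s;y,s'} = δ_{s,s'} D^∥_{x,y} + δ_{x,y} D^⊥_{s,s'}`
built on an arbitrary four-dimensional kernel `D` (FS: `D^∥`, the Wilson operator with the
"unconventional sign of the mass term"; instantiated in §5) with chirality matrix `γ`, mass parameter
`m` on the wall-to-wall links and `n` layers. [cite: FurmanShamir1995, §2 (5th display, D_F)]
[cite: Shamir1993, §3 eqs. (28)–(29)] -/
noncomputable def domainWall : Matrix (ι × Fin n) (ι × Fin n) ℂ :=
  D ⊗ₖ (1 : Matrix (Fin n) (Fin n) ℂ) + dwPerp γ m n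

/-- Unfolding lemma for `dwPerp` (`δ_{x,y}D^⊥`). [cite: FurmanShamir1995, §2 (7th display)] -/
theorem dwPerp_def :
    dwPerp γ m n =
      projR γ ⊗ₖ (sHop n - (m : ℂ) • sWrap n) + projL γ ⊗ₖ ((sHop n)ᵀ - (m : ℂ) • (sWrap n)ᵀ) - 1 :=
  rfl

/-- Unfolding lemma for `D_F = δ_{ss'}D^∥ + δ_{xy}D^⊥`. [cite: FurmanShamir1995, §2 (5th display)] -/
theorem domainWall_def : domainWall γ D m n = D ⊗ₖ (1 : Matrix (Fin n) (Fin n) ℂ) + dwPerp γ m n :=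
  rfl

/-- **FS's `D_F` entry by entry** (5th and 7th displays combined, layers numbered from `0`):
`(D_F)_{(x,s),(y,s')} = δ_{s,s'}D_{x,y} + (P_R)_{x,y}(δ_{s+1,s'} − m δ_{s,2N}δ_{1,s'})
+ (P_L)_{x,y}(δ_{s−1,s'} − m δ_{s,1}δ_{2N,s'}) − δ_{x,y}δ_{s,s'}`.
[cite: FurmanShamir1995, §2 (5th and 7th displays)] -/
theorem domainWall_apply (x y : ι) (s t : Fin n) :
    domainWall γ D m n (x, s) (y, t) =
      (if s = t then D x y else 0) +
        (projR γ x y * ((if t.val = s.val + 1 then 1 else 0) -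
            (m : ℂ) * (if s.val + 1 = n ∧ t.val = 0 then 1 else 0)) +
          projL γ x y * ((if s.val = t.val + 1 then 1 else 0) -
            (m : ℂ) * (if t.val + 1 = n ∧ s.val = 0 then 1 else 0))) -
        (if x = y ∧ s = t then 1 else 0) := by
  simp only [domainWall, dwPerp, Matrix.add_apply, Matrix.sub_apply, Matrix.kronecker_apply,
    Matrix.one_apply, Matrix.smul_apply, transpose_apply, sHop_apply, sWrap_apply, smul_eq_mul,
    Prod.mk.injEq, mul_ite, mul_one, mul_zero]
  ring

/-- **The mass enters only through the wall-to-wall links**, with coefficient `−m`: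
`D_F(m₁) − D_F(m₂) = (m₂ − m₁)·(P_R ⊗ B + P_L ⊗ Bᵀ)` ("the couplings which reside on the links
connecting the layers `s = 2N` and `s = 1` are proportional to a parameter `−m`").
[cite: FurmanShamir1995, §2 (text before the 1st display; 7th display)] [cite: Shamir1993, §3 eq. (29)] -/
theorem domainWall_sub_domainWall (m₁ m₂ : ℝ) :
    domainWall γ D m₁ n - domainWall γ D m₂ n =
      ((m₂ - m₁ : ℝ) : ℂ) • (projR γ ⊗ₖ sWrap n + projL γ ⊗ₖ (sWrap n)ᵀ) := by
  ext ⟨x, s⟩ ⟨y, t⟩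
  simp only [domainWall, dwPerp, Matrix.add_apply, Matrix.sub_apply, Matrix.kronecker_apply,
    Matrix.smul_apply, smul_eq_mul, Complex.ofReal_sub]
  ring

/-- **`m = 0`: open boundaries** — no wall-to-wall link: `D_F(0) = D ⊗ 1 + P_R ⊗ A + P_L ⊗ Aᵀ − 1`
("The case `m = 0` corresponds to open boundaries"; Shamir (28): "cutting the link connecting the sites
`s = 0` and `s = N`"). [cite: FurmanShamir1995, §2 (text before the 1st display)] [cite: Shamir1993, §3 eq. (28)] -/
theorem domainWall_zero :
    domainWall γ D 0 n = D ⊗ₖ (1 : Matrix (Fin n) (Fin n) ℂ) +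
      (projR γ ⊗ₖ sHop n + projL γ ⊗ₖ (sHop n)ᵀ - 1) := by
  simp [domainWall, dwPerp]

/-- **`m = 1`: antiperiodic boundary conditions** in the fifth direction — the forward hop becomes the
antiperiodic circulant `A − B` (wrap-around link with sign `−1`) and the backward hop its transpose
("The case `m = 1` corresponds to antiperiodic boundary conditions, where the model supports no light
fermionic state"; the Pauli–Villars lattice). [cite: FurmanShamir1995, §2 (text before the 1st display; 10th display)] -/
theorem domainWall_one :
    domainWall γ D 1 n = D ⊗ₖ (1 : Matrix (Fin n) (Fin n) ℂ) +
      (projR γ ⊗ₖ (sHop n - sWrap n) + projL γ ⊗ₖ (sHop n - sWrap n)ᵀ - 1) := by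
  simp [domainWall, dwPerp, transpose_sub]

end Defs

section Gamma

variable (γ : Matrix ι ι ℂ) (n : ℕ)

/-- **`γ₅𝓡`** as one matrix on `ι × Fin n`: `γ ⊗ 𝓡`. [cite: FurmanShamir1995, §2 (12th display, γ₅𝓡)] -/
noncomputable def dwGamma : Matrix (ι × Fin n) (ι × Fin n) ℂ :=
  γ ⊗ₖ sReflect n

/-- Unfolding lemma for `γ₅𝓡 = γ ⊗ 𝓡`. [cite: FurmanShamir1995, §2 (12th display)] -/
theorem dwGamma_def : dwGamma γ n = γ ⊗ₖ sReflect n := rfl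

variable {γ}

/-- `(γ ⊗ 𝓡)† = γ ⊗ 𝓡` when `γ† = γ`. [cite: FurmanShamir1995, §2 (11th–12th displays)] -/
theorem conjTranspose_dwGamma (hγ : γᴴ = γ) : (dwGamma γ n)ᴴ = dwGamma γ n := by
  rw [dwGamma, Matrix.conjTranspose_kronecker, hγ, conjTranspose_sReflect]

variable [Fintype ι]

/-- Conjugating a Kronecker product by `γ ⊗ 𝓡` conjugates the factors. [folklore] -/
private theorem dwGamma_mul_kronecker_mul_dwGamma (X : Matrix ι ι ℂ) (Y : Matrix (Fin n) (Fin n) ℂ) :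
    dwGamma γ n * (X ⊗ₖ Y) * dwGamma γ n = (γ * X * γ) ⊗ₖ (sReflect n * Y * sReflect n) := by
  rw [dwGamma, ← Matrix.mul_kronecker_mul, ← Matrix.mul_kronecker_mul]

variable [DecidableEq ι]

/-- `(γ ⊗ 𝓡)² = 1` when `γ² = 1`. [cite: FurmanShamir1995, §2 (11th–12th displays)] -/
theorem dwGamma_mul_self (hγγ : γ * γ = 1) : dwGamma γ n * dwGamma γ n = 1 := by
  rw [dwGamma, ← Matrix.mul_kronecker_mul, hγγ, sReflect_mul_sReflect, Matrix.one_kronecker_one]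

/-- `det(γ ⊗ 𝓡)` is a unit (indeed `±1`, `det_dwGamma_sq`). [cite: FurmanShamir1995, §2 (14th display)] -/
theorem isUnit_det_dwGamma (hγγ : γ * γ = 1) : IsUnit (dwGamma γ n).det :=
  Matrix.isUnit_det_of_left_inverse (dwGamma_mul_self n hγγ)

/-- `(γ ⊗ 𝓡)⁻¹ = γ ⊗ 𝓡`. [cite: FurmanShamir1995, §2 (11th–12th displays)] -/
theorem dwGamma_inv (hγγ : γ * γ = 1) : (dwGamma γ n)⁻¹ = dwGamma γ n :=
  Matrix.inv_eq_left_inv (dwGamma_mul_self n hγγ)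

/-- `det(γ ⊗ 𝓡)² = 1` ("`det(γ₅𝓡) = 1` trivially" — in general `±1`; `= 1` for the Wilson instance,
`det_wilsonDwGamma`). [cite: FurmanShamir1995, §2 (14th display)] -/
theorem det_dwGamma_sq (hγγ : γ * γ = 1) : (dwGamma γ n).det ^ 2 = 1 := by
  rw [sq, ← det_mul, dwGamma_mul_self n hγγ, det_one]

end Gamma

/-! ## §4 `γ₅𝓡`-hermiticity, the Hermitian operator `γ₅𝓡D_F`, the real determinant -/

section Hermiticity

variable [Fintype ι] [DecidableEq ι] {γ D : Matrix ι ι ℂ} (m : ℝ) (n : ℕ)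

/-- **Reflection hermiticity of the fifth-direction part**: `(δD^⊥)† = (γ ⊗ 𝓡)(δD^⊥)(γ ⊗ 𝓡)` for
`γ† = γ`, `γ² = 1` — the reflection swaps `δ_{s+1,s'} ↔ δ_{s−1,s'}` and the two wall links, `γ₅`
fixes `P_{R,L}`, and the adjoint does the same swap. [cite: FurmanShamir1995, §2 (12th display)] -/
theorem conjTranspose_dwPerp (hγ : γᴴ = γ) (hγγ : γ * γ = 1) :
    (dwPerp γ m n)ᴴ = dwGamma γ n * dwPerp γ m n * dwGamma γ n := by
  have hm : star (m : ℂ) = m := by rw [Complex.star_def, Complex.conj_ofReal]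
  have hL : (sHop n - (m : ℂ) • sWrap n)ᴴ = (sHop n)ᵀ - (m : ℂ) • (sWrap n)ᵀ := by
    rw [conjTranspose_sub, conjTranspose_smul, conjTranspose_sHop, conjTranspose_sWrap, hm]
  have hLt : ((sHop n)ᵀ - (m : ℂ) • (sWrap n)ᵀ)ᴴ = sHop n - (m : ℂ) • sWrap n := by
    rw [conjTranspose_sub, conjTranspose_smul, conjTranspose_sHop_transpose,
      conjTranspose_sWrap_transpose, hm]
  have hA : sReflect n * (sHop n - (m : ℂ) • sWrap n) * sReflect n =
      (sHop n)ᵀ - (m : ℂ) • (sWrap n)ᵀ := by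
    rw [Matrix.mul_sub, Matrix.sub_mul, Matrix.mul_smul, Matrix.smul_mul,
      sReflect_mul_sHop_mul_sReflect, sReflect_mul_sWrap_mul_sReflect]
  have hAt : sReflect n * ((sHop n)ᵀ - (m : ℂ) • (sWrap n)ᵀ) * sReflect n =
      sHop n - (m : ℂ) • sWrap n := by
    rw [Matrix.mul_sub, Matrix.sub_mul, Matrix.mul_smul, Matrix.smul_mul,
      sReflect_mul_sHop_transpose_mul_sReflect, sReflect_mul_sWrap_transpose_mul_sReflect]
  rw [dwPerp, conjTranspose_sub, conjTranspose_add, Matrix.conjTranspose_kronecker,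
    Matrix.conjTranspose_kronecker, conjTranspose_one, conjTranspose_projR hγ, conjTranspose_projL hγ,
    hL, hLt, Matrix.mul_sub, Matrix.sub_mul, Matrix.mul_add, Matrix.add_mul, Matrix.mul_one,
    dwGamma_mul_self n hγγ, dwGamma_mul_kronecker_mul_dwGamma, dwGamma_mul_kronecker_mul_dwGamma,
    gamma_mul_projR_mul_gamma hγγ, gamma_mul_projL_mul_gamma hγγ, hA, hAt]

/-- **FURMAN–SHAMIR'S REFLECTION IDENTITY `𝓡γ₅ D_F 𝓡γ₅ = D_F†`** (written `D_F† = (γ ⊗ 𝓡) D_F (γ ⊗ 𝓡)`),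
for every kernel `D` that is `γ₅`-Hermitian, `D† = γ D γ` ("a generalization of a similar relation
obeyed by the four dimensional Dirac operator for Wilson fermions, which reads `γ₅D^∥γ₅ = (D^∥)†`"),
`γ† = γ`, `γ² = 1`; every real `m`, every number of layers `n`.
[cite: FurmanShamir1995, §2 (12th display, from the 13th)] -/
theorem conjTranspose_domainWall (hγ : γᴴ = γ) (hγγ : γ * γ = 1) (hD : Dᴴ = γ * D * γ) :
    (domainWall γ D m n)ᴴ = dwGamma γ n * domainWall γ D m n * dwGamma γ n := by
  rw [domainWall, conjTranspose_add, Matrix.conjTranspose_kronecker, conjTranspose_one, hD,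
    conjTranspose_dwPerp m n hγ hγγ, Matrix.mul_add, Matrix.add_mul,
    dwGamma_mul_kronecker_mul_dwGamma, Matrix.mul_one, sReflect_mul_sReflect]

/-- The same identity with the inverse, `D_F† = Γ D_F Γ⁻¹`, `Γ = γ ⊗ 𝓡` — the form used by the tree's
`GammaHermiticity` API. [cite: FurmanShamir1995, §2 (12th display)] -/
theorem conjTranspose_domainWall' (hγ : γᴴ = γ) (hγγ : γ * γ = 1) (hD : Dᴴ = γ * D * γ) :
    (domainWall γ D m n)ᴴ = dwGamma γ n * domainWall γ D m n * (dwGamma γ n)⁻¹ := by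
  rw [dwGamma_inv n hγγ, conjTranspose_domainWall m n hγ hγγ hD]

/-- **"reflection implies that the operator `γ₅𝓡 D_F` is hermitian"** — so it "can be used in the
definition of the fermionic action instead of `D_F`". [cite: FurmanShamir1995, §2 (text after the 13th display; 15th display)] -/
theorem isHermitian_dwGamma_mul_domainWall (hγ : γᴴ = γ) (hγγ : γ * γ = 1) (hD : Dᴴ = γ * D * γ) :
    (dwGamma γ n * domainWall γ D m n).IsHermitian := by
  have h := TwistedMass.isHermitian_hermQ (conjTranspose_dwGamma n hγ) (dwGamma_mul_self n hγγ)
    (conjTranspose_domainWall m n hγ hγγ hD)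
  rwa [TwistedMass.hermQ_def] at h

/-- **"As a result, the fermionic determinant is real"**: `(det D_F)* = det D_F`.
[cite: FurmanShamir1995, §2 (14th display and the sentence after it)] -/
theorem star_det_domainWall (hγ : γᴴ = γ) (hγγ : γ * γ = 1) (hD : Dᴴ = γ * D * γ) :
    star (domainWall γ D m n).det = (domainWall γ D m n).det :=
  QuantumFieldTheory.GammaHermiticity.star_det_eq_det (isUnit_det_dwGamma n hγγ)
    (conjTranspose_domainWall' m n hγ hγγ hD)

/-- **The one-flavour domain-wall determinant is real**: `Im det D_F = 0` ("However, one cannot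
conclude that the fermionic determinant is necessarily positive").
[cite: FurmanShamir1995, §2 (14th display and the sentence after it)] -/
theorem det_domainWall_im (hγ : γᴴ = γ) (hγγ : γ * γ = 1) (hD : Dᴴ = γ * D * γ) :
    (domainWall γ D m n).det.im = 0 :=
  QuantumFieldTheory.GammaHermiticity.det_im_eq_zero (isUnit_det_dwGamma n hγγ)
    (conjTranspose_domainWall' m n hγ hγγ hD)

/-- `det D_F = Re det D_F` (as a complex number). [cite: FurmanShamir1995, §2 (14th display)] -/
theorem det_domainWall_eq_ofReal_re (hγ : γᴴ = γ) (hγγ : γ * γ = 1) (hD : Dᴴ = γ * D * γ) :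
    (domainWall γ D m n).det = ((domainWall γ D m n).det.re : ℂ) :=
  QuantumFieldTheory.GammaHermiticity.det_eq_ofReal_re (isUnit_det_dwGamma n hγγ)
    (conjTranspose_domainWall' m n hγ hγγ hD)

/-- **`det(D_F) = det(γ₅𝓡 D_F)` up to the sign `det(γ₅𝓡) = ±1`**: `det(Γ D_F) = det Γ · det D_F` with
`(det Γ)² = 1` (`det_dwGamma_sq`; `det Γ = 1` in the Wilson instance, `det_wilsonDwGamma`).
[cite: FurmanShamir1995, §2 (14th display)] -/
theorem det_dwGamma_mul_domainWall :
    (dwGamma γ n * domainWall γ D m n).det = (dwGamma γ n).det * (domainWall γ D m n).det :=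
  det_mul _ _

/-- The γ₅-type spectral pairing carries over: the characteristic polynomial of `D_F` is self-conjugate,
so the non-real eigenvalues come in complex-conjugate pairs of equal multiplicity (tree:
`GammaHermiticity.rootMultiplicity_conj`). [cite: FurmanShamir1995, §2 (12th display; consequence as for Wilson fermions)] -/
theorem rootMultiplicity_charpoly_conj (hγ : γᴴ = γ) (hγγ : γ * γ = 1) (hD : Dᴴ = γ * D * γ) (μ : ℂ) :
    (domainWall γ D m n).charpoly.rootMultiplicity (starRingEnd ℂ μ) =
      (domainWall γ D m n).charpoly.rootMultiplicity μ :=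
  QuantumFieldTheory.GammaHermiticity.rootMultiplicity_conj (isUnit_det_dwGamma n hγγ)
    (conjTranspose_domainWall' m n hγ hγγ hD) μ

/-! ### Two flavours and the Pauli–Villars second-order operator -/

/-- **The second-order operator `D_F†D_F`** (the Pauli–Villars action's "square of the Dirac operator",
FS 10th display with `(n, m) = (N, 1)`; also the two-degenerate-flavour kernel) has determinant
`|det D_F|²` — real and non-negative, for ANY `γ`, `D`, `m`, `n` (no hermiticity needed).
[cite: FurmanShamir1995, §2 (10th display, S_PV)] -/
theorem det_conjTranspose_mul_domainWall :
    ((domainWall γ D m n)ᴴ * domainWall γ D m n).det.re = ‖(domainWall γ D m n).det‖ ^ 2 ∧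
      ((domainWall γ D m n)ᴴ * domainWall γ D m n).det.im = 0 := by
  rw [← TwistedMass.tmKernel_zero]
  exact ⟨TwistedMass.det_tmKernel_zero_re _, (TwistedMass.det_tmKernel_nonneg _ 0).2⟩

/-- `det(D_F†D_F) ≥ 0`. [cite: FurmanShamir1995, §2 (10th display, S_PV) and App. B (even N_f)] -/
theorem det_conjTranspose_mul_domainWall_nonneg :
    0 ≤ ((domainWall γ D m n)ᴴ * domainWall γ D m n).det.re := by
  rw [(det_conjTranspose_mul_domainWall m n).1]
  positivity

/-- **"For even `N_f` … the factor `(det D_F(U))^{N_f}` is positive"** (non-negative; strictly positive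
iff `det D_F ≠ 0`): an even power of the REAL number `det D_F`.
[cite: FurmanShamir1995, App. B ('For even N_f or for m > 0, the factor (det D_F(U))^{N_f} is positive')] -/
theorem det_domainWall_pow_re_nonneg (hγ : γᴴ = γ) (hγγ : γ * γ = 1) (hD : Dᴴ = γ * D * γ) {k : ℕ}
    (hk : Even k) :
    0 ≤ ((domainWall γ D m n).det ^ k).re ∧ ((domainWall γ D m n).det ^ k).im = 0 := by
  rw [det_domainWall_eq_ofReal_re m n hγ hγγ hD, ← Complex.ofReal_pow, Complex.ofReal_re,
    Complex.ofReal_im]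
  exact ⟨hk.pow_nonneg _, rfl⟩

/-- The even power is strictly positive as soon as `D_F` is non-singular.
[cite: FurmanShamir1995, App. B (even N_f)] -/
theorem det_domainWall_pow_re_pos (hγ : γᴴ = γ) (hγγ : γ * γ = 1) (hD : Dᴴ = γ * D * γ) {k : ℕ}
    (hk : Even k) (hdet : (domainWall γ D m n).det ≠ 0) :
    0 < ((domainWall γ D m n).det ^ k).re := by
  have hre : (domainWall γ D m n).det.re ≠ 0 := by
    intro h
    apply hdet
    rw [det_domainWall_eq_ofReal_re m n hγ hγγ hD, h, Complex.ofReal_zero]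
  rw [det_domainWall_eq_ofReal_re m n hγ hγγ hD, ← Complex.ofReal_pow, Complex.ofReal_re]
  exact hk.pow_pos hre

/-- **The `N_f = 2` Pauli–Villars-regulated weight is a non-negative real**:
`det(D_F(m)†D_F(m)) / det(D_F(1)†D_F(1)) = |det D_F(m)|²/|det D_F(1)|² ≥ 0` (the light doublet over the
`m = 1` subtraction; FS's PV lattice has half as many layers, which changes nothing here: any `n, n'`).
[cite: FurmanShamir1995, §2 (10th display, S_PV with m = 1) and App. B] -/
theorem pv_ratio_nonneg (m : ℝ) (n n' : ℕ) :
    0 ≤ ((domainWall γ D m n)ᴴ * domainWall γ D m n).det.re /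
        ((domainWall γ D 1 n')ᴴ * domainWall γ D 1 n').det.re :=
  div_nonneg (det_conjTranspose_mul_domainWall_nonneg m n) (det_conjTranspose_mul_domainWall_nonneg 1 n')

end Hermiticity

end Operator

/-! ## §5 The instance: the tree's gauge-covariant Wilson–Dirac operator on the four-torus -/

section Wilson

open Literature.Probability.LatticeModels Literature.MathematicalPhysics.QuantumFieldTheory

variable {L N : ℕ} {G : Type*} [Group G] (ρ : G →* Matrix (Fin N) (Fin N) ℂ)

/-- **Lattice QCD's domain-wall quark matrix**: FS's `D_F` built on the tree's gauge-covariant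
Wilson–Dirac operator `wilsonDirac ρ U M r` (`GrassmannIntegral.lean`) as the four-dimensional kernel
`D^∥`, with `Γ₅ = 1 ⊗ 1 ⊗ γ₅` (`spinorLift gammaFive`).  FS's operator at domain-wall height `M` on `2N`
layers is `wilsonDomainWall ρ U M (−1) m (2N)`: their `D^∥ = (M−4)δ_{x,y} + ½Σ_μ[(1+γ_μ)U_{x,μ}δ_{x+μ̂,y}
+ (1−γ_μ)U†_{y,μ}δ_{x−μ̂,y}]` is the tree's `(m + 4r)δ − ½Σ_μ[(r−γ_μ)ρ(U(x,μ))δ_{y,x+μ̂} + (r+γ_μ)ρ(U(y,μ))⁻¹δ_{x,y+μ̂}]`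
at `(m, r) = (M, −1)` ("apart from the unconventional sign of the mass term, `D^∥` is the usual … Dirac
operator for massive Wilson fermions"); all results below hold for every `(M, r)`.
[cite: FurmanShamir1995, §2 (5th–7th displays)] [cite: Shamir1993, §3 eq. (29)] -/
noncomputable def wilsonDomainWall (U : GaugeConfig 4 L G) (M r m : ℝ) (n : ℕ) :
    Matrix ((TorusSite 4 L × Fin N × Fin 4) × Fin n) ((TorusSite 4 L × Fin N × Fin 4) × Fin n) ℂ :=
  domainWall (spinorLift gammaFive) (wilsonDirac ρ U M r) m n

/-- `γ₅𝓡 = Γ₅ ⊗ 𝓡` on the five-dimensional index. [cite: FurmanShamir1995, §2 (12th display)] -/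
noncomputable def wilsonDwGamma (L N n : ℕ) :
    Matrix ((TorusSite 4 L × Fin N × Fin 4) × Fin n) ((TorusSite 4 L × Fin N × Fin 4) × Fin n) ℂ :=
  dwGamma (spinorLift gammaFive : Matrix (TorusSite 4 L × Fin N × Fin 4) _ ℂ) n

/-- Unfolding lemma for the Wilson domain-wall quark matrix. [cite: FurmanShamir1995, §2 (5th–7th displays)] -/
theorem wilsonDomainWall_def (U : GaugeConfig 4 L G) (M r m : ℝ) (n : ℕ) :
    wilsonDomainWall ρ U M r m n = domainWall (spinorLift gammaFive) (wilsonDirac ρ U M r) m n := rfl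

/-- Unfolding lemma for `Γ₅ ⊗ 𝓡`. [cite: FurmanShamir1995, §2 (12th display)] -/
theorem wilsonDwGamma_def (L N n : ℕ) :
    wilsonDwGamma L N n = dwGamma (spinorLift gammaFive : Matrix (TorusSite 4 L × Fin N × Fin 4) _ ℂ) n :=
  rfl

/-- **FS's `D^∥` (6th display) IS the tree's Wilson–Dirac operator at `r = −1`, entry by entry**:
`wilsonDirac ρ U M (−1) = ½Σ_μ[(1+γ_μ)ρ(U_{x,μ})δ_{x+μ̂,y} + (1−γ_μ)ρ(U_{y,μ})⁻¹δ_{x−μ̂,y}] + (M−4)δ_{x,y}`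
(FS write `U†_{y,μ}` for the backward link, `= ρ(U_{y,μ})⁻¹` for a unitary representation; their "`M`"
is the domain-wall height and "the unconventional sign of the mass term" is the tree's `r = −1`).
[cite: FurmanShamir1995, §2 (6th display, D^∥)] -/
theorem wilsonDirac_neg_one_apply (U : GaugeConfig 4 L G) (M : ℝ)
    (p q : TorusSite 4 L × Fin N × Fin 4) :
    wilsonDirac ρ U M (-1) p q =
      (1 / 2 : ℂ) * ∑ μ : Fin 4,
          ((if q.1 = Site.shift p.1 μ then
              ((1 : Matrix (Fin 4) (Fin 4) ℂ) + euclideanGamma μ) p.2.2 q.2.2 * ρ (U (p.1, μ)) p.2.1 q.2.1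
            else 0) +
            (if p.1 = Site.shift q.1 μ then
              ((1 : Matrix (Fin 4) (Fin 4) ℂ) - euclideanGamma μ) p.2.2 q.2.2 * ρ (U (q.1, μ))⁻¹ p.2.1 q.2.1
            else 0)) +
        (if p = q then ((M - 4 : ℝ) : ℂ) else 0) := by
  have key : ∀ μ : Fin 4,
      ((if q.1 = Site.shift p.1 μ then
          (((-1 : ℝ) : ℂ) • (1 : Matrix (Fin 4) (Fin 4) ℂ) - euclideanGamma μ) p.2.2 q.2.2 *
            ρ (U (p.1, μ)) p.2.1 q.2.1 else 0) +
        (if p.1 = Site.shift q.1 μ then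
          (((-1 : ℝ) : ℂ) • (1 : Matrix (Fin 4) (Fin 4) ℂ) + euclideanGamma μ) p.2.2 q.2.2 *
            ρ (U (q.1, μ))⁻¹ p.2.1 q.2.1 else 0)) =
      -((if q.1 = Site.shift p.1 μ then
          ((1 : Matrix (Fin 4) (Fin 4) ℂ) + euclideanGamma μ) p.2.2 q.2.2 * ρ (U (p.1, μ)) p.2.1 q.2.1
          else 0) +
        (if p.1 = Site.shift q.1 μ then
          ((1 : Matrix (Fin 4) (Fin 4) ℂ) - euclideanGamma μ) p.2.2 q.2.2 * ρ (U (q.1, μ))⁻¹ p.2.1 q.2.1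
          else 0)) := by
    intro μ
    simp only [Matrix.sub_apply, Matrix.add_apply, Matrix.smul_apply, smul_eq_mul, Complex.ofReal_neg,
      Complex.ofReal_one]
    split_ifs <;> ring
  have hm : ((M + 4 * (-1 : ℝ) : ℝ) : ℂ) = ((M - 4 : ℝ) : ℂ) := by
    congr 1; ring
  simp only [wilsonDirac, Matrix.of_apply, key, Finset.sum_neg_distrib, hm]
  ring

/-- `det Γ₅ = 1` (each site and colour contributes `det diag(1,1,−1,−1) = 1`); re-proved here (6 lines)
rather than importing `Barriers/QuantumFields/WilsonDeterminantSign.lean` (`det_spinorLift_gammaFive`)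
into this topic file. [folklore] -/
private theorem det_spinorLift_gammaFive' [NeZero L] :
    (spinorLift gammaFive : Matrix (TorusSite 4 L × Fin N × Fin 4) _ ℂ).det = 1 := by
  rw [spinorLift_gammaFive_eq_diagonal, det_diagonal, Fintype.prod_prod_type, Finset.prod_eq_one]
  intro x _
  rw [Fintype.prod_prod_type, Finset.prod_eq_one]
  intro a _
  simp [Fin.prod_univ_four]

/-- The five-dimensional index has an even number of four-dimensional components (`4` spins).
[folklore] -/
private theorem even_card_index [NeZero L] : Even (Fintype.card (TorusSite 4 L × Fin N × Fin 4)) := by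
  simp only [Fintype.card_prod, Fintype.card_fin]
  exact ⟨Fintype.card (TorusSite 4 L) * (N * 2), by ring⟩

/-- **"One has `det(γ₅𝓡) = 1` trivially"**: `det(Γ₅ ⊗ 𝓡) = (det Γ₅)^n · (det 𝓡)^{4N L⁴} = 1`
(`det Γ₅ = 1`, `(det 𝓡)² = 1` and the exponent is even). [cite: FurmanShamir1995, §2 (14th display)] -/
theorem det_wilsonDwGamma [NeZero L] (n : ℕ) : (wilsonDwGamma L N n).det = 1 := by
  obtain ⟨k, hk⟩ := even_card_index (L := L) (N := N)
  rw [wilsonDwGamma, dwGamma, Matrix.det_kronecker, det_spinorLift_gammaFive', one_pow, one_mul, hk,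
    ← two_mul, pow_mul, det_sReflect_sq, one_pow]

/-- **`𝓡γ₅ D_F 𝓡γ₅ = D_F†` FOR LATTICE QCD**: on EVERY gauge field `U` (any gauge group, any unitary colour
representation `ρ`, `L ≥ 1`), every `(M, r)`, every wall mass `m` and number of layers `n`,
`D_F† = (Γ₅ ⊗ 𝓡) D_F (Γ₅ ⊗ 𝓡)` — from the tree's `γ₅ D_W γ₅ = D_W†`
(`TwistedMass.conjTranspose_wilsonDirac`, Montvay–Münster (4.35) = FS's 13th display).
[cite: FurmanShamir1995, §2 (12th–13th displays)] [cite: MontvayMunster1994, §4.2 (4.35)] -/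
theorem conjTranspose_wilsonDomainWall [NeZero L] (hρ : ∀ g, ρ g ∈ Matrix.unitaryGroup (Fin N) ℂ)
    (U : GaugeConfig 4 L G) (M r m : ℝ) (n : ℕ) :
    (wilsonDomainWall ρ U M r m n)ᴴ =
      wilsonDwGamma L N n * wilsonDomainWall ρ U M r m n * wilsonDwGamma L N n :=
  conjTranspose_domainWall m n TwistedMass.conjTranspose_spinorLift_gammaFive spinorLift_gammaFive_mul_self
    (TwistedMass.conjTranspose_wilsonDirac ρ hρ U M r)

/-- **`γ₅𝓡 D_F` is Hermitian on every gauge field** (the operator one may use "in the definition of the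
fermionic action instead of `D_F`", and whose square is the HMC kernel).
[cite: FurmanShamir1995, §2 (text after the 13th display)] -/
theorem isHermitian_gammaR_mul_wilsonDomainWall [NeZero L]
    (hρ : ∀ g, ρ g ∈ Matrix.unitaryGroup (Fin N) ℂ) (U : GaugeConfig 4 L G) (M r m : ℝ) (n : ℕ) :
    (wilsonDwGamma L N n * wilsonDomainWall ρ U M r m n).IsHermitian :=
  isHermitian_dwGamma_mul_domainWall m n TwistedMass.conjTranspose_spinorLift_gammaFive
    spinorLift_gammaFive_mul_self (TwistedMass.conjTranspose_wilsonDirac ρ hρ U M r)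

/-- **FS's 14th display verbatim: `det(D_F) = det(γ₅𝓡 D_F)`** on every gauge field.
[cite: FurmanShamir1995, §2 (14th display)] -/
theorem det_wilsonDomainWall_eq_det_gammaR_mul [NeZero L] (U : GaugeConfig 4 L G) (M r m : ℝ) (n : ℕ) :
    (wilsonDomainWall ρ U M r m n).det = (wilsonDwGamma L N n * wilsonDomainWall ρ U M r m n).det := by
  rw [det_mul, det_wilsonDwGamma, one_mul]

/-- **"As a result, the fermionic determinant is real"** — for the domain-wall quark matrix of lattice
QCD on every gauge field: `Im det D_F(U) = 0` (and, FS: "one cannot conclude that the fermionic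
determinant is necessarily positive"). [cite: FurmanShamir1995, §2 (14th display and the sentence after it)] -/
theorem det_wilsonDomainWall_im [NeZero L] (hρ : ∀ g, ρ g ∈ Matrix.unitaryGroup (Fin N) ℂ)
    (U : GaugeConfig 4 L G) (M r m : ℝ) (n : ℕ) :
    (wilsonDomainWall ρ U M r m n).det.im = 0 :=
  det_domainWall_im m n TwistedMass.conjTranspose_spinorLift_gammaFive spinorLift_gammaFive_mul_self
    (TwistedMass.conjTranspose_wilsonDirac ρ hρ U M r)

/-- `(det D_F(U))* = det D_F(U)`. [cite: FurmanShamir1995, §2 (14th display)] -/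
theorem star_det_wilsonDomainWall [NeZero L] (hρ : ∀ g, ρ g ∈ Matrix.unitaryGroup (Fin N) ℂ)
    (U : GaugeConfig 4 L G) (M r m : ℝ) (n : ℕ) :
    star (wilsonDomainWall ρ U M r m n).det = (wilsonDomainWall ρ U M r m n).det :=
  star_det_domainWall m n TwistedMass.conjTranspose_spinorLift_gammaFive spinorLift_gammaFive_mul_self
    (TwistedMass.conjTranspose_wilsonDirac ρ hρ U M r)

/-- **The Pauli–Villars / two-flavour second-order operator `D_F(U)†D_F(U)` has determinant
`|det D_F(U)|² ≥ 0` on every gauge field** (no hypothesis on `ρ`).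
[cite: FurmanShamir1995, §2 (10th display, S_PV)] -/
theorem det_conjTranspose_mul_wilsonDomainWall [NeZero L] (U : GaugeConfig 4 L G) (M r m : ℝ) (n : ℕ) :
    ((wilsonDomainWall ρ U M r m n)ᴴ * wilsonDomainWall ρ U M r m n).det.re =
        ‖(wilsonDomainWall ρ U M r m n).det‖ ^ 2 ∧
      ((wilsonDomainWall ρ U M r m n)ᴴ * wilsonDomainWall ρ U M r m n).det.im = 0 :=
  det_conjTranspose_mul_domainWall m n

/-- **"For even `N_f` … `(det D_F(U))^{N_f}` is positive"** (a non-negative real) on every gauge field.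
[cite: FurmanShamir1995, App. B] -/
theorem det_wilsonDomainWall_pow_re_nonneg [NeZero L] (hρ : ∀ g, ρ g ∈ Matrix.unitaryGroup (Fin N) ℂ)
    (U : GaugeConfig 4 L G) (M r m : ℝ) (n : ℕ) {k : ℕ} (hk : Even k) :
    0 ≤ ((wilsonDomainWall ρ U M r m n).det ^ k).re ∧ ((wilsonDomainWall ρ U M r m n).det ^ k).im = 0 :=
  det_domainWall_pow_re_nonneg m n TwistedMass.conjTranspose_spinorLift_gammaFive
    spinorLift_gammaFive_mul_self (TwistedMass.conjTranspose_wilsonDirac ρ hρ U M r) hk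

/-- The `N_f = 2` domain-wall weight with its `m = 1` Pauli–Villars subtraction,
`det(D_F(m)†D_F(m)) / det(D_F(1)†D_F(1))`, is `≥ 0` on every gauge field (positivity by construction for
the light doublet; the PV lattice may have any number of layers `n'`).
[cite: FurmanShamir1995, §2 (10th display) and App. B] -/
theorem wilson_pv_ratio_nonneg [NeZero L] (U : GaugeConfig 4 L G) (M r m : ℝ) (n n' : ℕ) :
    0 ≤ ((wilsonDomainWall ρ U M r m n)ᴴ * wilsonDomainWall ρ U M r m n).det.re /
        ((wilsonDomainWall ρ U M r 1 n')ᴴ * wilsonDomainWall ρ U M r 1 n').det.re :=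
  pv_ratio_nonneg m n n'

end Wilson

end Literature.MathematicalPhysics.QuantumLattice.DomainWall
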